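import Summits.NavierStokesRegularity.NavierStokesRegularity.Theorems.AdaptedFrequencyFrequencyRigidityFlatBackwardSingularTools
import HarnessLib

/-!
# Crux `FrequencyRigidity` (stmt-NavierStokesRegularity-2955), line `scaled-energy-split`:
# flat inhabitants are BACKWARD-SINGULAR at the pole

Helper file 2 of 2 (`--supports stmt-NavierStokesRegularity-2955`; theorems only, sorry-free; tools in
`AdaptedFrequencyFrequencyRigidityFlatBackwardSingularTools.lean`).  Leaf of Stub 2
(`stub_finiteScaledEnergyLiouville`, the finite Albritton–Barker-energy piece): a *flat inhabitant* — a
jointly smooth field `v` on `ℝ³ × (−∞,0)` with the scale-invariant bounds `‖Dᵏv(t)‖ ≤ C'_k (−t)^{−(k+1)/2}`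
(`k = 1, 2`), an adapted two-sided Gaussian-comparable kernel `K` at the pole `(0,0)` and the EXACT
enstrophy law `H(t) = ∫ ‖curl v(t)‖² K(t) = A(−t)⁻²`, `A > 0` (the normal form every witness of the crux
takes, `TwoEndedPinning.stub_flatReduction`) — is NOT essentially bounded on any backward parabolic ball
`Q((0,0), r)`: the space–time origin is a singular point in the backward sense of Albritton–Barker 2019
(`IsBackwardSingularPoint v 0`).  This is the hypothesis under which the staffed target
`NoTypeIRateProfile` (stmt-1588) and Seregin–Šverák's axisymmetric theorem conclude, so it is the hinge
of the bridges `Stub 2 ⇐ stmt-1588` and of the axisymmetric leaf of Stub 2.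

Proof (physical variables, no local regularity theory).  If `‖v‖ ≤ M` on `Q((0,0),r)`, the mean value
inequality with the GLOBAL bound `‖D²v(t)‖ ≤ C'₂(−t)^{−3/2}` gives, for `‖x‖ < r/2`, `0 < h < r/2`,
`‖Dv(t,x)‖ ≤ 2M/h + C'₂(−t)^{−3/2}h`; with `h = λ√(−t)` the kernel-weighted enstrophy of the ball
`B_{r/2}` is `≤ 8‖curl‖²M²(−t)⁻¹/λ² + 2‖curl‖²C'₂²λ²(−t)⁻²`, while outside the ball the Gaussian upper
bound and `‖curl v‖ ≤ ‖curl‖C'₁(−t)⁻¹` make the contribution `o((−t)⁻²)`.  Choosing `λ` small and then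
`t ↑ 0` contradicts `(−t)²H(t) = A > 0`.

## References

* D. Albritton, T. Barker, *On local Type I singularities of the Navier–Stokes equations and Liouville
  theorems*, J. Math. Fluid Mech. 21 (2019), §1 (singular points, backward form). [AlbrittonBarker2019]
* G. Koch, N. Nadirashvili, G. Seregin, V. Šverák, Acta Math. 203 (2009), §4 (scale-invariant bounds). [KochNadirashviliSereginSverak2009]
-/

noncomputable section

set_option linter.dupNamespace false

namespace Summit.NavierStokesRegularity.NavierStokesRegularity.Theorems.FrequencyRigidity.ScaledEnergySplit

open Literature.Analysis.FluidPDE MeasureTheory Set Filter Topology Function Metric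
open scoped RealInnerProductSpace ENNReal

open Summit.NavierStokesRegularity.NavierStokesRegularity.Theorems.FrequencyRigidity.Negative (E3)

/-! ## Flat inhabitants are unbounded near the pole -/

/-- **A flat inhabitant is unbounded on every backward parabolic ball about the pole** (core of
`isBackwardSingularPoint_of_flat`).  Hypotheses: joint smoothness of `v` on `(−∞,0) × ℝ³`, the
scale-invariant bounds, an adapted Gaussian-comparable kernel at `(0,0)`, and the flat law
`H(t) = A(−t)⁻²` with `A > 0`; conclusion: no bound `‖v‖ ≤ M` on `(−r², 0) × B_r(0)`. [cite: AlbrittonBarker2019, §1] -/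
theorem flat_not_bounded_near_pole {ν A : ℝ} {C' : ℕ → ℝ} {v : ℝ → E3 → E3} {K : ℝ → E3 → ℝ}
    (hv : IsSmoothSpaceTimeOn (Iio 0) v)
    (hB : ∀ k : ℕ, 1 ≤ k → ∀ t : ℝ, t < 0 → ∀ x : E3,
      ‖iteratedFDeriv ℝ k (v t) x‖ ≤ C' k * (-t) ^ (-((k : ℝ) + 1) / 2))
    (hK : IsAdaptedBackwardKernel ν v (Iio 0) 0 0 K) (hG : IsGaussianComparable K (Iio 0) 0 0)
    (hA : 0 < A) (hflat : ∀ t : ℝ, t < 0 → adaptedEnstrophy v K t = A * (-t) ^ (-(2 : ℝ)))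
    {r M : ℝ} (hr : 0 < r)
    (hM : ∀ t ∈ Ioo (-r ^ 2) 0, ∀ x ∈ ball (0 : E3) r, ‖v t x‖ ≤ M) : False := by
  -- constants
  obtain ⟨c₁, c₂, C₁, C₂, -, -, hC₁, hC₂, hcmp⟩ := isGaussianComparable_iff_fin_three.1 hG
  obtain ⟨c, hc⟩ : ∃ c : ℝ, c = ‖curlCLM‖ := ⟨_, rfl⟩
  have hc0 : 0 ≤ c := by rw [hc]; exact norm_nonneg curlCLM
  obtain ⟨D₁, hD₁⟩ : ∃ D : ℝ, D = C' 1 := ⟨_, rfl⟩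
  obtain ⟨D₂, hD₂⟩ : ∃ D : ℝ, D = C' 2 := ⟨_, rfl⟩
  have hr2 : 0 < r ^ 2 := by positivity
  have hM0 : 0 ≤ M := by
    have ht : -r ^ 2 / 2 ∈ Ioo (-r ^ 2) 0 := ⟨by linarith, by linarith⟩
    exact (norm_nonneg _).trans (hM _ ht 0 (mem_ball_self hr))
  have hD₁0 : 0 ≤ D₁ := by
    have h := (norm_nonneg _).trans (hB 1 le_rfl (-1) (by norm_num) 0)
    rw [← hD₁] at h
    exact nonneg_of_mul_nonneg_left h (Real.rpow_pos_of_pos (by norm_num) _)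
  have hD₂0 : 0 ≤ D₂ := by
    have h := (norm_nonneg _).trans (hB 2 (by norm_num) (-1) (by norm_num) 0)
    rw [← hD₂] at h
    exact nonneg_of_mul_nonneg_left h (Real.rpow_pos_of_pos (by norm_num) _)
  -- the length-scale parameter `λ` of the Taylor step, fixed by `2c²D₂²λ² ≤ A/4`
  have hden : 0 < 8 * c ^ 2 * D₂ ^ 2 + 1 := by positivity
  obtain ⟨lam, hlam0, hlam2⟩ : ∃ lam : ℝ, 0 < lam ∧ lam ^ 2 = A / (8 * c ^ 2 * D₂ ^ 2 + 1) :=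
    ⟨Real.sqrt (A / (8 * c ^ 2 * D₂ ^ 2 + 1)), Real.sqrt_pos.2 (div_pos hA hden),
      Real.sq_sqrt (div_pos hA hden).le⟩
  have hterm2 : 2 * c ^ 2 * D₂ ^ 2 * lam ^ 2 ≤ A / 4 := by
    rw [hlam2, mul_div_assoc', div_le_div_iff₀ hden (by norm_num : (0:ℝ) < 4)]
    nlinarith [mul_nonneg (sq_nonneg c) (sq_nonneg D₂), hA.le]
  -- the frozen Gaussian `g` of the tail and its mass `I₀`
  have hb₀0 : 0 < (2 * C₂ * r ^ 2)⁻¹ := by positivity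
  obtain ⟨g, hg⟩ : ∃ g : E3 → ℝ, g = fun x => Real.exp (-(2 * C₂ * r ^ 2)⁻¹ * ‖x‖ ^ 2) := ⟨_, rfl⟩
  have hg_int : Integrable g := hg ▸ TwoEndedPinning.kernelPairing_integrable_exp_neg_mul_sq_norm hb₀0
  have hg0 : ∀ x, 0 ≤ g x := fun x => by rw [hg]; exact (Real.exp_pos _).le
  obtain ⟨I₀, hI₀⟩ : ∃ I : ℝ, I = ∫ x, g x := ⟨_, rfl⟩
  have hI₀0 : 0 ≤ I₀ := hI₀ ▸ integral_nonneg hg0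
  obtain ⟨β, hβ⟩ : ∃ β : ℝ, β = 128 * (c * D₁) ^ 2 * C₁ * C₂ ^ 2 * I₀ / r ^ 4 := ⟨_, rfl⟩
  have hβ0 : 0 ≤ β := by rw [hβ]; positivity
  -- choose the time `t = −q²` close to the pole
  have hev1 : ∀ᶠ q in 𝓝[>] (0:ℝ), q ∈ Ioo 0 r := Ioo_mem_nhdsGT hr
  have hev2 : ∀ᶠ q in 𝓝[>] (0:ℝ), lam * q < r / 2 := by
    refine Filter.Tendsto.eventually_lt_const (half_pos hr) ?_
    have : Tendsto (fun q : ℝ => lam * q) (𝓝 0) (𝓝 (lam * 0)) :=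
      (continuous_const.mul continuous_id).tendsto 0
    rw [mul_zero] at this
    exact this.mono_left nhdsWithin_le_nhds
  have hev3 : ∀ᶠ q in 𝓝[>] (0:ℝ), 8 * c ^ 2 * M ^ 2 * q ^ 2 / lam ^ 2 < A / 4 := by
    refine Filter.Tendsto.eventually_lt_const (by positivity) ?_
    have : Tendsto (fun q : ℝ => 8 * c ^ 2 * M ^ 2 * q ^ 2 / lam ^ 2) (𝓝 0)
        (𝓝 (8 * c ^ 2 * M ^ 2 * 0 ^ 2 / lam ^ 2)) :=
      ((continuous_const.mul (continuous_id.pow 2)).div_const _).tendsto 0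
    rw [zero_pow two_ne_zero, mul_zero, zero_div] at this
    exact this.mono_left nhdsWithin_le_nhds
  have hev4 : ∀ᶠ q in 𝓝[>] (0:ℝ), β * q < A / 4 := by
    refine Filter.Tendsto.eventually_lt_const (by positivity) ?_
    have : Tendsto (fun q : ℝ => β * q) (𝓝 0) (𝓝 (β * 0)) :=
      (continuous_const.mul continuous_id).tendsto 0
    rw [mul_zero] at this
    exact this.mono_left nhdsWithin_le_nhds
  obtain ⟨q, ⟨⟨⟨hq0, hqr⟩, hE2⟩, hE3⟩, hE4⟩ := (((hev1.and hev2).and hev3).and hev4).exists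
  have hq0' : q ≠ 0 := hq0.ne'
  have hq2 : 0 < q ^ 2 := by positivity
  have hq2r : q ^ 2 < r ^ 2 := by nlinarith
  -- the slice at `t = −q²`
  obtain ⟨t, htq⟩ : ∃ t : ℝ, t = -q ^ 2 := ⟨_, rfl⟩
  have ht : t < 0 := by rw [htq]; linarith
  have ht' : t ∈ Iio (0:ℝ) := ht
  have hnt : -t = q ^ 2 := by rw [htq, neg_neg]
  have htI : t ∈ Ioo (-r ^ 2) 0 := ⟨by rw [htq]; linarith, ht⟩
  -- (1) the scale-invariant bounds at time `t`
  have hD2t : ∀ x, ‖iteratedFDeriv ℝ 2 (v t) x‖ ≤ D₂ / q ^ 3 := by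
    intro x
    have h := hB 2 (by norm_num) t ht x
    rw [hnt, show (-(((2:ℕ) : ℝ) + 1) / 2 : ℝ) = -((3:ℕ) : ℝ) / 2 by norm_num,
      sq_rpow_neg_div_two hq0 3, ← hD₂, ← div_eq_mul_inv] at h
    exact h
  have hcurl : ∀ x, ‖curl (v t) x‖ ≤ c * D₁ / q ^ 2 := by
    intro x
    have h := TwoEndedPinning.norm_curl_le_of_bounds hB ht x
    rw [hnt, Real.rpow_neg_one, ← hc, ← hD₁, ← div_eq_mul_inv] at h
    exact h
  have hKup : ∀ x, K t x ≤ C₁ / q ^ 3 * Real.exp (-(‖x‖ ^ 2) / (C₂ * q ^ 2)) := by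
    intro x
    have h := (hcmp t ht' x).2
    rw [show (0:ℝ) - t = q ^ 2 by rw [htq]; ring, sub_zero,
      show (-(3:ℝ) / 2) = -((3:ℕ) : ℝ) / 2 by norm_num, sq_rpow_neg_div_two hq0 3,
      ← div_eq_mul_inv] at h
    exact h
  have hflat_t : ∫ x, ‖curl (v t) x‖ ^ 2 * K t x = A / q ^ 4 := by
    rw [← adaptedEnstrophy_apply, hflat t ht, hnt,
      show (-(2:ℝ)) = -((4:ℕ) : ℝ) / 2 by norm_num, sq_rpow_neg_div_two hq0 4, div_eq_mul_inv]
  -- (2) the gradient bound on the half ball (Taylor step `h = λ q`)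
  have hv2 : ContDiff ℝ 2 (v t) := (hv.contDiff_slice ht').of_le (by norm_cast)
  have hgrad : ∀ x ∈ ball (0 : E3) (r / 2),
      ‖fderiv ℝ (v t) x‖ ≤ 2 * M / (lam * q) + D₂ / q ^ 3 * (lam * q) := by
    intro x hx
    refine norm_fderiv_le_of_norm_le (ρ := r / 2) hv2 (fun y hy => hM t htI y ?_) hD2t
      (mul_pos hlam0 hq0) hE2
    rw [mem_ball, dist_zero_right] at hx ⊢
    rw [mem_ball, dist_eq_norm] at hy
    calc ‖y‖ = ‖(y - x) + x‖ := by rw [sub_add_cancel]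
      _ ≤ ‖y - x‖ + ‖x‖ := norm_add_le _ _
      _ < r / 2 + r / 2 := add_lt_add hy hx
      _ = r := by ring
  -- (3) the pointwise majorant of the enstrophy density
  obtain ⟨a, ha⟩ : ∃ a : ℝ, a = 2 * c ^ 2 * ((2 * M / (lam * q)) ^ 2 + (D₂ * lam / q ^ 2) ^ 2) :=
    ⟨_, rfl⟩
  have ha0 : 0 ≤ a := by rw [ha]; positivity
  obtain ⟨b, hb⟩ : ∃ b : ℝ,
      b = (c * D₁ / q ^ 2) ^ 2 * (C₁ / q ^ 3) * Real.exp (-(r ^ 2 / (8 * C₂ * q ^ 2))) := ⟨_, rfl⟩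
  have hb0 : 0 ≤ b := by rw [hb]; positivity
  have hmaj : ∀ x, ‖curl (v t) x‖ ^ 2 * K t x ≤ a * K t x + b * g x := by
    intro x
    have hKpos : 0 < K t x := hK.pos t ht' x
    by_cases hx : ‖x‖ < r / 2
    · -- inside the half ball: Taylor gradient bound
      have h1 : ‖curl (v t) x‖ ≤ c * (2 * M / (lam * q) + D₂ * lam / q ^ 2) := by
        have h := (norm_curl_le _ _).trans (mul_le_mul_of_nonneg_left
          (hgrad x (by rwa [mem_ball, dist_zero_right])) (norm_nonneg curlCLM))
        rwa [← hc, alg_taylor_term hq0'] at h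
      have h2 : ‖curl (v t) x‖ ^ 2 ≤ a :=
        (pow_le_pow_left₀ (norm_nonneg _) h1 2).trans (ha ▸ alg_sq_sum_le _ _ _)
      calc ‖curl (v t) x‖ ^ 2 * K t x ≤ a * K t x := mul_le_mul_of_nonneg_right h2 hKpos.le
        _ ≤ a * K t x + b * g x := le_add_of_nonneg_right (mul_nonneg hb0 (hg0 x))
    · -- outside: Gaussian tail against the `(−t)⁻¹` vorticity bound
      rw [not_lt] at hx
      have hx2 : r ^ 2 / 4 ≤ ‖x‖ ^ 2 := by
        have : (r / 2) ^ 2 ≤ ‖x‖ ^ 2 := pow_le_pow_left₀ (by positivity) hx 2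
        linarith
      have h1 : ‖curl (v t) x‖ ^ 2 ≤ (c * D₁ / q ^ 2) ^ 2 :=
        pow_le_pow_left₀ (norm_nonneg _) (hcurl x) 2
      have hexp : Real.exp (-(‖x‖ ^ 2) / (C₂ * q ^ 2)) ≤
          Real.exp (-(r ^ 2 / (8 * C₂ * q ^ 2))) * g x := by
        rw [hg, ← Real.exp_add, Real.exp_le_exp]
        exact alg_exponent_le hC₂ hq0 hr hq2r.le hx2
      calc ‖curl (v t) x‖ ^ 2 * K t x
          ≤ (c * D₁ / q ^ 2) ^ 2 * (C₁ / q ^ 3 * Real.exp (-(‖x‖ ^ 2) / (C₂ * q ^ 2))) :=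
            mul_le_mul h1 (hKup x) hKpos.le (sq_nonneg _)
        _ ≤ (c * D₁ / q ^ 2) ^ 2 * (C₁ / q ^ 3 * (Real.exp (-(r ^ 2 / (8 * C₂ * q ^ 2))) * g x)) := by
            gcongr
        _ = b * g x := by rw [hb]; ring
        _ ≤ a * K t x + b * g x := le_add_of_nonneg_left (mul_nonneg ha0 hKpos.le)
  -- (4) integrate the majorant
  have hF_int : Integrable fun x => ‖curl (v t) x‖ ^ 2 * K t x := by
    by_contra h
    rw [integral_undef h] at hflat_t
    exact (div_pos hA (by positivity)).ne' hflat_t.symm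
  have hKi : Integrable (K t) := hK.integrable ht'
  have hRHS_int : Integrable fun x => a * K t x + b * g x :=
    (hKi.const_mul a).add (hg_int.const_mul b)
  have hint : A / q ^ 4 ≤ a + b * I₀ := by
    rw [← hflat_t]
    calc ∫ x, ‖curl (v t) x‖ ^ 2 * K t x ≤ ∫ x, (a * K t x + b * g x) :=
          integral_mono hF_int hRHS_int hmaj
      _ = a * (∫ x, K t x) + b * (∫ x, g x) := by
          rw [integral_add (hKi.const_mul a) (hg_int.const_mul b),
            integral_const_mul, integral_const_mul]
      _ = a + b * I₀ := by rw [hK.integral_eq_one t ht', mul_one, hI₀]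
  -- (5) multiply by `q⁴ = (−t)²` and evaluate the three terms
  have hq4 : 0 < q ^ 4 := by positivity
  have hmain : A ≤ a * q ^ 4 + b * I₀ * q ^ 4 := by
    have h := (div_le_iff₀ hq4).1 hint
    linarith only [h]
  have hterm1 : a * q ^ 4 = 8 * c ^ 2 * M ^ 2 * q ^ 2 / lam ^ 2 + 2 * c ^ 2 * D₂ ^ 2 * lam ^ 2 := by
    rw [ha]
    exact alg_inner_mul hq0' hlam0.ne'
  have hterm3 : b * I₀ * q ^ 4 ≤ β * q := by
    have hexp := exp_neg_tail_le hr hC₂ hq0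
    rw [hb, alg_tail_mul hq0', hβ, ← alg_tail_final hq0' hr.ne']
    exact mul_le_mul_of_nonneg_left hexp (by positivity)
  have hfin : A < A :=
    calc A ≤ a * q ^ 4 + b * I₀ * q ^ 4 := hmain
      _ ≤ 8 * c ^ 2 * M ^ 2 * q ^ 2 / lam ^ 2 + 2 * c ^ 2 * D₂ ^ 2 * lam ^ 2 + β * q := by
          rw [hterm1]; linarith only [hterm3]
      _ < A / 4 + A / 4 + A / 4 := by linarith only [hE3, hterm2, hE4]
      _ < A := by linarith only [hA]
  exact lt_irrefl _ hfin

/-- **A flat inhabitant is pointwise unbounded on every backward parabolic ball about the pole.** [cite: AlbrittonBarker2019, §1] -/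
theorem flat_unbounded_near_pole {ν A : ℝ} {C' : ℕ → ℝ} {v : ℝ → E3 → E3} {K : ℝ → E3 → ℝ}
    (hv : IsSmoothSpaceTimeOn (Iio 0) v)
    (hB : ∀ k : ℕ, 1 ≤ k → ∀ t : ℝ, t < 0 → ∀ x : E3,
      ‖iteratedFDeriv ℝ k (v t) x‖ ≤ C' k * (-t) ^ (-((k : ℝ) + 1) / 2))
    (hK : IsAdaptedBackwardKernel ν v (Iio 0) 0 0 K) (hG : IsGaussianComparable K (Iio 0) 0 0)
    (hA : 0 < A) (hflat : ∀ t : ℝ, t < 0 → adaptedEnstrophy v K t = A * (-t) ^ (-(2 : ℝ)))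
    {r : ℝ} (hr : 0 < r) (M : ℝ) :
    ∃ t ∈ Ioo (-r ^ 2) 0, ∃ x ∈ ball (0 : E3) r, M < ‖v t x‖ := by
  by_contra h
  push Not at h
  exact flat_not_bounded_near_pole hv hB hK hG hA hflat hr h

/-- **Flat inhabitants are backward-singular at the pole** (Albritton–Barker's notion,
`IsBackwardSingularPoint v 0`: `v ∉ L^∞(Q((0,0), r))` for every `r > 0`).  The space–time origin of a
flat inhabitant is therefore exactly the kind of point the target `NoTypeIRateProfile` (stmt-1588) and
Seregin–Šverák's axisymmetric Type-I theorem declare impossible in their classes. [cite: AlbrittonBarker2019, §1] -/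
theorem isBackwardSingularPoint_of_flat {ν A : ℝ} {C' : ℕ → ℝ} {v : ℝ → E3 → E3} {K : ℝ → E3 → ℝ}
    (hv : IsSmoothSpaceTimeOn (Iio 0) v)
    (hB : ∀ k : ℕ, 1 ≤ k → ∀ t : ℝ, t < 0 → ∀ x : E3,
      ‖iteratedFDeriv ℝ k (v t) x‖ ≤ C' k * (-t) ^ (-((k : ℝ) + 1) / 2))
    (hK : IsAdaptedBackwardKernel ν v (Iio 0) 0 0 K) (hG : IsGaussianComparable K (Iio 0) 0 0)
    (hA : 0 < A) (hflat : ∀ t : ℝ, t < 0 → adaptedEnstrophy v K t = A * (-t) ^ (-(2 : ℝ))) :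
    IsBackwardSingularPoint v 0 := by
  intro r hr
  by_contra hne
  have hlt : eLpNorm (uncurry v) ∞ (volume.restrict (parabolicCylinder r (0 : ℝ × E3))) < ∞ :=
    lt_top_iff_ne_top.2 hne
  have hsub : parabolicCylinder r (0 : ℝ × E3) ⊆ Iio (0:ℝ) ×ˢ univ := by
    intro z hz
    rw [mem_parabolicCylinder] at hz
    exact ⟨hz.1.2, mem_univ _⟩
  have hcont : ContinuousOn (uncurry v) (parabolicCylinder r (0 : ℝ × E3)) :=
    hv.continuousOn.mono hsub
  have hbd := norm_le_of_eLpNorm_top_lt_top (isOpen_parabolicCylinder r _) hcont hlt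
  refine flat_not_bounded_near_pole hv hB hK hG hA hflat hr
    (M := (eLpNorm (uncurry v) ∞ (volume.restrict (parabolicCylinder r (0 : ℝ × E3)))).toReal)
    fun t ht x hx => ?_
  have hz : (t, x) ∈ parabolicCylinder r (0 : ℝ × E3) := by
    rw [mem_parabolicCylinder]
    refine ⟨⟨?_, ?_⟩, ?_⟩
    · simpa using ht.1
    · simpa using ht.2
    · simpa using hx
  exact hbd (t, x) hz

/-- **Registered sub-goal `stub_flatBackwardSingular` of Stub 2 (line `scaled-energy-split`)**: flat
inhabitants are backward-singular at the pole (= `isBackwardSingularPoint_of_flat`, closed form). [cite: AlbrittonBarker2019, §1] -/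
theorem stub_flatBackwardSingular : ∀ (ν A : ℝ) (C' : ℕ → ℝ) (v : ℝ → EuclideanSpace ℝ (Fin 3) → EuclideanSpace ℝ (Fin 3)) (K : ℝ → EuclideanSpace ℝ (Fin 3) → ℝ), Literature.Analysis.FluidPDE.IsSmoothSpaceTimeOn (Set.Iio 0) v → (∀ k : ℕ, 1 ≤ k → ∀ t : ℝ, t < 0 → ∀ x : EuclideanSpace ℝ (Fin 3), ‖iteratedFDeriv ℝ k (v t) x‖ ≤ C' k * (-t) ^ (-((k : ℝ) + 1) / 2)) → Literature.Analysis.FluidPDE.IsAdaptedBackwardKernel ν v (Set.Iio 0) 0 0 K → Literature.Analysis.FluidPDE.IsGaussianComparable K (Set.Iio 0) 0 0 → 0 < A → (∀ t : ℝ, t < 0 → Literature.Analysis.FluidPDE.adaptedEnstrophy v K t = A * (-t) ^ (-(2 : ℝ))) → Literature.Analysis.FluidPDE.IsBackwardSingularPoint v 0 :=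
  fun _ _ _ _ _ hv hB hK hG hA hflat => isBackwardSingularPoint_of_flat hv hB hK hG hA hflat

/-! ## From the crux body: every witness of `FrequencyRigidity` is backward-singular at the pole -/

/-- **The flat package of a witness.**  Any `(ν, C, Λ₀, v, q, K)` inhabiting the body of `FrequencyRigidity`
(clause bundles of `Negative/Clauses.lean`) is a flat inhabitant: scale-invariant bounds
(`TwoEndedPinning.scaleInvariantBounds`, KNSS), adapted Gaussian-comparable kernel, and `H(t) = A(−t)⁻²`
with `A = H(−1) > 0` (`Λ₀ = 2` by the landed pinning (T)).  Extracted verbatim from the proof of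
`TwoEndedPinning.frequencyRigidity_of_flatEnstrophyLiouville`. [cite: KochNadirashviliSereginSverak2009, §4] -/
theorem exists_flat_of_witness {ν C Λ₀ : ℝ} {v : ℝ → E3 → E3} {q : ℝ → E3 → ℝ} {K : ℝ → E3 → ℝ}
    (hν : 0 < ν) (hNS : IsClassicalNSSolutionOn (Iio 0) ν 0 v q) (hTI : Negative.TypeIBound C v)
    (hKc : Negative.KernelClauses ν v K) (hCmp : Negative.Comparable K) (hF : Negative.FreqClause v K Λ₀) :
    ∃ (A : ℝ) (C' : ℕ → ℝ), 0 < A ∧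
      (∀ k : ℕ, 1 ≤ k → ∀ t : ℝ, t < 0 → ∀ x : E3,
        ‖iteratedFDeriv ℝ k (v t) x‖ ≤ C' k * (-t) ^ (-((k : ℝ) + 1) / 2)) ∧
      IsAdaptedBackwardKernel ν v (Iio 0) 0 0 K ∧ IsGaussianComparable K (Iio 0) 0 0 ∧
      (∀ t : ℝ, t < 0 → adaptedEnstrophy v K t = A * (-t) ^ (-(2 : ℝ))) := by
  have hTI' : HasTypeITimeDecay C v := fun t ht x => hTI t ht x
  obtain ⟨hK1, hK2, hK3, hK4, hK5⟩ := hKc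
  have hK : IsAdaptedBackwardKernel ν v (Iio 0) 0 0 K := ⟨hK1, hK2, hK3, hK4, hK5⟩
  obtain ⟨c₁, c₂, C₁, C₂, hc₁, hc₂, hC₁, hC₂, hcmp⟩ := hCmp
  have hG : IsGaussianComparable K (Iio 0) 0 0 :=
    isGaussianComparable_iff_fin_three.2 ⟨c₁, c₂, C₁, C₂, hc₁, hc₂, hC₁, hC₂, hcmp⟩
  obtain ⟨C', hC'⟩ := TwoEndedPinning.scaleInvariantBounds ν C hν
  have hB := hC' v q hNS hTI'
  have hFV : ∀ t : ℝ, t < 0 → HasDerivAt (adaptedEnstrophy v K)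
      (∫ x, (2 * (⟪curl (v t) x, fderiv ℝ (v t) x (curl (v t) x)⟫
        - ν * frobeniusNormSq (fderiv ℝ (curl (v t)) x))) * K t x) t :=
    fun t ht => TwoEndedPinning.enstrophyFirstVariation ν C C' v q K hNS hTI' hB hK hG ht
  have hd : ∀ t < 0, DifferentiableAt ℝ (fun t => ∫ x, ‖curl (v t) x‖ ^ 2 * K t x) t :=
    fun t ht => (hFV t ht).differentiableAt
  have hM : ∀ t < 0, (∫ x, ‖curl (v t) x‖ ^ 2 * K t x) ≤
      (‖curlCLM‖ * C' 1) ^ 2 * (-t) ^ (-(2 : ℝ)) :=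
    fun t ht => TwoEndedPinning.adaptedEnstrophy_le_of_bounds hB hK ht
  have hΛ : Λ₀ = 2 := hF.exponent_eq_two hd hM
  refine ⟨∫ x, ‖curl (v (-1)) x‖ ^ 2 * K (-1) x, C', ?_, hB, hK, hG, ?_⟩
  · exact (hF _ _ rfl rfl).1 (-1) (by norm_num)
  · intro t ht
    rw [adaptedEnstrophy_apply, hF.power_law hd ht, hΛ]

/-- **Every witness of the crux body is backward-singular at the pole**: for `(ν, C, Λ₀, v, q, K)` in the
body of `FrequencyRigidity`, the velocity `v` is not essentially bounded on any `Q((0,0), r)`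
(`IsBackwardSingularPoint v 0`).  The finite piece `stub_finiteScaledEnergyLiouville` therefore asks
exactly for a *Type-I singular point in the Albritton–Barker class* — the object excluded by
`NoTypeIRateProfile` (stmt-1588) and, under axial symmetry, by `axisymmetricTypeIExclusion_of_tree`. [cite: AlbrittonBarker2019, §1] -/
theorem isBackwardSingularPoint_of_witness {ν C Λ₀ : ℝ} {v : ℝ → E3 → E3} {q : ℝ → E3 → ℝ}
    {K : ℝ → E3 → ℝ} (hν : 0 < ν) (hNS : IsClassicalNSSolutionOn (Iio 0) ν 0 v q)
    (hTI : Negative.TypeIBound C v) (hKc : Negative.KernelClauses ν v K) (hCmp : Negative.Comparable K)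
    (hF : Negative.FreqClause v K Λ₀) : IsBackwardSingularPoint v 0 := by
  obtain ⟨A, C', hA, hB, hK, hG, hflat⟩ := exists_flat_of_witness hν hNS hTI hKc hCmp hF
  exact isBackwardSingularPoint_of_flat hNS.smooth_velocity hB hK hG hA hflat

end Summit.NavierStokesRegularity.NavierStokesRegularity.Theorems.FrequencyRigidity.ScaledEnergySplit

end
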